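import Mathlib
import Summits.Schanuel.Schanuel.Theorems.RigidCoreMinimalCounterexampleInAclSecondLevelSelectionProd
import Summits.Schanuel.Schanuel.Theorems.RigidCoreMinimalCounterexampleInAclSecondLevelSelectionCos

/-!
# The split of (S*) after gen 19 — crux stmt-Schanuel-0969 `RigidCore.MinimalCounterexampleInAcl`

Route `RigidCore`, crux (S*) `MinimalCounterexampleInAcl` (item stmt-Schanuel-0969), line `kernel-arithmetic-selection`
(lead prover-line-stmt-Schanuel-0969-c6-0, skeleton gen 19d), `--supports stmt-Schanuel-0969`; registered stub
`crux_iff_twistedResidue_and_geThree`; and the GADGET SCHEMA `gadget_selection` for future gadgets.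

**(S*) ⟺ [every PURE rank-2 first failure at which the gadgets `e^{x₀²}`, `e^{x₀x₁}`, `e^{x₁²}`, `e^{ix₀}`, `e^{ix₁}` are ALL transcendental
over `ℚ(x, eˣ)` has both coordinates in `acl^{ℂ_exp}(∅)`] ∧ item stmt-14744** (`crux_iff_twistedResidue_and_geThree`): the quadratic split
(…SecondLevelSelectionProd.lean p126091) refined by the twisted selection (…SecondLevelSelectionCos.lean, `stub_secondLevelSelectionCos`).
-/

noncomputable section

set_option linter.dupNamespace false

open Complex Set FirstOrder

namespace Summit.Schanuel.Schanuel.Cruxes.MinimalCounterexampleInAcl.KernelArithmeticSelection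

open Literature.ModelTheory.ExponentialFields
open Summit.Schanuel.Schanuel.Theorems.AclSubsetLogFreeCore.Negative
open Summit.Schanuel.Schanuel.Theses.RigidCore (MinimalCounterexampleInAcl MinimalCounterexampleInAclGeThree)

/-! ## The gadget schema -/

/-- **THE GADGET SCHEMA of the line** (for future gadgets): let `x` be a rank-2 first failure with `x₀` transcendental and `Φ` a
`∅`-definable function that DEGENERATES super-polynomially along the mates (at each far mate `‖Φ y‖ (1+‖y₀‖)^M ≤ 1` or
`‖Φ y‖⁻¹ (1+‖y₀‖)^M ≤ 1`).  If `Φ x ≠ 0` is ALGEBRAIC over `ℚ(x, eˣ)` then both coordinates of `x` lie in `acl^{ℂ_exp}(∅)` —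
normal form of the relation (`stub_relationNormalForm`), growth of the coefficients (`stub_mateCoeffGrowth`), local finiteness of the
mates (`stub_matesLocallyFinite`) and the two-sided selection core (`selectionCoreTwoSided_of_head`). [cite: KirbyMacintyreOnshuus2012, §2] -/
theorem gadget_selection {x : Fin 2 → ℂ} (hx : x ∈ firstFailures 2) (hx0 : Transcendental ℚ (x 0))
    {Φ : (Fin 2 → ℂ) → ℂ} (hΦ : (∅ : Set ℂ).DefinableFun Language.expRing Φ)
    (hdeg : ∀ M : ℕ, ∃ R : ℝ, ∀ y : Fin 2 → ℂ, y ∈ locusMates x → R ≤ ‖y 0‖ →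
      ‖Φ y‖ * (1 + ‖y 0‖) ^ M ≤ 1 ∨ ‖Φ y‖⁻¹ * (1 + ‖y 0‖) ^ M ≤ 1)
    (hne : Φ x ≠ 0) (halg : IsAlgebraic ↥(IntermediateField.adjoin ℚ (range x ∪ range (cexp ∘ x))) (Φ x)) :
    ∀ i, x i ∈ expAcl := by
  obtain ⟨d, c, hc0, hrel⟩ := stub_relationNormalForm x (Φ x) hne halg
  exact selectionCoreTwoSided_of_head hx hΦ hdeg (stub_mateCoeffGrowth x hx.2.1 hx0) (stub_matesLocallyFinite x hx hx0)
    c hc0 hrel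

/-- **The gadget schema without the transcendence hypothesis on `x₀`** (an algebraic coordinate is settled by the landed
acl-criterion). [cite: KirbyMacintyreOnshuus2012, §2] -/
theorem gadget_selection' {x : Fin 2 → ℂ} (hx : x ∈ firstFailures 2)
    {Φ : (Fin 2 → ℂ) → ℂ} (hΦ : (∅ : Set ℂ).DefinableFun Language.expRing Φ)
    (hdeg : Transcendental ℚ (x 0) → ∀ M : ℕ, ∃ R : ℝ, ∀ y : Fin 2 → ℂ, y ∈ locusMates x → R ≤ ‖y 0‖ →
      ‖Φ y‖ * (1 + ‖y 0‖) ^ M ≤ 1 ∨ ‖Φ y‖⁻¹ * (1 + ‖y 0‖) ^ M ≤ 1)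
    (hne : Φ x ≠ 0) (halg : IsAlgebraic ↥(IntermediateField.adjoin ℚ (range x ∪ range (cexp ∘ x))) (Φ x)) :
    ∀ i, x i ∈ expAcl := by
  by_cases h0 : IsAlgebraic ℚ (x 0)
  · exact firstFailure_two_mem_expAcl_of_isAlgebraic_coord hx h0
  · exact gadget_selection hx h0 hΦ (hdeg h0) hne halg

/-! ## The split -/

/-- **The quadratically-generic residue ⟺ its twisted part**: first failures with `e^{ix₀}` or `e^{ix₁}` algebraic over `ℚ(x,eˣ)`
are settled by `stub_secondLevelSelectionCos`. [cite: KirbyMacintyreOnshuus2012, §2] -/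
theorem quadraticResidue_iff_twistedResidue :
    (∀ x : Fin 2 → ℂ, x ∈ firstFailures 2 →
        (∀ M : Fin 2 → ℤ, M ≠ 0 → Transcendental ℚ (cexp (∑ i, (M i : ℂ) * x i))) →
        Transcendental ↥(IntermediateField.adjoin ℚ (range x ∪ range (cexp ∘ x))) (cexp (x 0 ^ 2)) →
        Transcendental ↥(IntermediateField.adjoin ℚ (range x ∪ range (cexp ∘ x))) (cexp (x 0 * x 1)) →
        Transcendental ↥(IntermediateField.adjoin ℚ (range x ∪ range (cexp ∘ x))) (cexp (x 1 ^ 2)) →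
        ∀ i, x i ∈ expAcl) ↔
      ∀ x : Fin 2 → ℂ, x ∈ firstFailures 2 →
        (∀ M : Fin 2 → ℤ, M ≠ 0 → Transcendental ℚ (cexp (∑ i, (M i : ℂ) * x i))) →
        Transcendental ↥(IntermediateField.adjoin ℚ (range x ∪ range (cexp ∘ x))) (cexp (x 0 ^ 2)) →
        Transcendental ↥(IntermediateField.adjoin ℚ (range x ∪ range (cexp ∘ x))) (cexp (x 0 * x 1)) →
        Transcendental ↥(IntermediateField.adjoin ℚ (range x ∪ range (cexp ∘ x))) (cexp (x 1 ^ 2)) →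
        Transcendental ↥(IntermediateField.adjoin ℚ (range x ∪ range (cexp ∘ x))) (cexp (I * x 0)) →
        Transcendental ↥(IntermediateField.adjoin ℚ (range x ∪ range (cexp ∘ x))) (cexp (I * x 1)) →
        ∀ i, x i ∈ expAcl := by
  refine ⟨fun h x hx hpure h00 h01 h11 _ _ i => h x hx hpure h00 h01 h11 i, fun h x hx hpure h00 h01 h11 i => ?_⟩
  by_cases hc0 : IsAlgebraic ↥(IntermediateField.adjoin ℚ (range x ∪ range (cexp ∘ x))) (cexp (I * x 0))
  · exact secondLevel_cos0 hx hc0 i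
  by_cases hc1 : IsAlgebraic ↥(IntermediateField.adjoin ℚ (range x ∪ range (cexp ∘ x))) (cexp (I * x 1))
  · exact secondLevel_cos1 hx hc1 i
  · exact h x hx hpure h00 h01 h11 hc0 hc1 i

/-- **Registered stub `crux_iff_twistedResidue_and_geThree` (PROVED): THE SPLIT AFTER GEN 19** — (S*) holds iff (i) every PURE
rank-2 first failure at which the quadratic gadgets `e^{x₀²}`, `e^{x₀x₁}`, `e^{x₁²}` AND the twisted gadgets `e^{ix₀}`, `e^{ix₁}` are
ALL transcendental over `ℚ(x, eˣ)` has both coordinates in `acl^{ℂ_exp}(∅)`, and (ii) item stmt-Schanuel-14744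
(`MinimalCounterexampleInAclGeThree`, ranks `≥ 3`) holds. [cite: Kirby2010, Prop. 7.2] -/
theorem crux_iff_twistedResidue_and_geThree : Summit.Schanuel.Schanuel.Theses.RigidCore.MinimalCounterexampleInAcl ↔ ((∀ x : Fin 2 → ℂ, x ∈ Summit.Schanuel.Schanuel.Cruxes.MinimalCounterexampleInAcl.KernelArithmeticSelection.firstFailures 2 → (∀ M : Fin 2 → ℤ, M ≠ 0 → Transcendental ℚ (Complex.exp (∑ i, (M i : ℂ) * x i))) → Transcendental ↥(IntermediateField.adjoin ℚ (Set.range x ∪ Set.range (Complex.exp ∘ x))) (Complex.exp (x 0 ^ 2)) → Transcendental ↥(IntermediateField.adjoin ℚ (Set.range x ∪ Set.range (Complex.exp ∘ x))) (Complex.exp (x 0 * x 1)) → Transcendental ↥(IntermediateField.adjoin ℚ (Set.range x ∪ Set.range (Complex.exp ∘ x))) (Complex.exp (x 1 ^ 2)) → Transcendental ↥(IntermediateField.adjoin ℚ (Set.range x ∪ Set.range (Complex.exp ∘ x))) (Complex.exp (Complex.I * x 0)) → Transcendental ↥(IntermediateField.adjoin ℚ (Set.range x ∪ Set.range (Complex.exp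 ∘ x))) (Complex.exp (Complex.I * x 1)) → ∀ i, x i ∈ Summit.Schanuel.Schanuel.Theorems.AclSubsetLogFreeCore.Negative.expAcl) ∧ Summit.Schanuel.Schanuel.Theses.RigidCore.MinimalCounterexampleInAclGeThree) := by
  rw [crux_iff_quadraticResidue_and_geThree, quadraticResidue_iff_twistedResidue]

/-- **(S*) from the twisted-generic pure residue and item stmt-14744.** [cite: Kirby2010, Prop. 7.2] -/
theorem crux_of_twistedResidue_of_geThree
    (hR : ∀ x : Fin 2 → ℂ, x ∈ firstFailures 2 →
        (∀ M : Fin 2 → ℤ, M ≠ 0 → Transcendental ℚ (cexp (∑ i, (M i : ℂ) * x i))) →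
        Transcendental ↥(IntermediateField.adjoin ℚ (range x ∪ range (cexp ∘ x))) (cexp (x 0 ^ 2)) →
        Transcendental ↥(IntermediateField.adjoin ℚ (range x ∪ range (cexp ∘ x))) (cexp (x 0 * x 1)) →
        Transcendental ↥(IntermediateField.adjoin ℚ (range x ∪ range (cexp ∘ x))) (cexp (x 1 ^ 2)) →
        Transcendental ↥(IntermediateField.adjoin ℚ (range x ∪ range (cexp ∘ x))) (cexp (I * x 0)) →
        Transcendental ↥(IntermediateField.adjoin ℚ (range x ∪ range (cexp ∘ x))) (cexp (I * x 1)) →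
        ∀ i, x i ∈ expAcl)
    (h₃ : MinimalCounterexampleInAclGeThree) : MinimalCounterexampleInAcl :=
  crux_iff_twistedResidue_and_geThree.2 ⟨hR, h₃⟩

end Summit.Schanuel.Schanuel.Cruxes.MinimalCounterexampleInAcl.KernelArithmeticSelection

end
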